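import Literature.Geometry.Lorentzian.KerrConvergence
import Literature.Geometry.Lorentzian.KerrSurfaceGravity
import HarnessLib

/-!
# Crux `ClusterCompleteness.OmegaLimitMultiKerr` (stmt-FinalStateConjecture-14664), line `Sketch` —
# no phantom holes: truncated boosted-Kerr slabs are nonempty

Structure stub of the line lead (gen 3) for the crux `OmegaLimitMultiKerr` ("for every order `k`,
Christodoulou-generically an MGHD exists and every MGHD that does NOT settle down RECURS at order
`k`"), over the tree's `ModelBackground.truncTimeSlab` / `truncLateRegion` and
`boostedKerrBackground` (`Literature.Geometry.Lorentzian.KerrConvergence`).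

The recurrence clause of `Recurs k 𝒟` (route `ClusterCompleteness`, rev 16;
`ClusterCompletenessOmegaLimitMultiKerrDefs`) asks `Cᵏ` `ε`-closeness of each hole chart to boosted
Kerr on the truncated Kerr–Schild slabs `truncTimeSlab R' τ = {t* ∘ P⁻¹ = τ, r ∘ P⁻¹ ≤ R'}` for EVERY
radius `R'` (repair F1: the pre-repair interface only asked closeness out to existential radii
`Rᵢ(τ)`, and `Rᵢ ≡ 0 < r₊` made every certified slab EMPTY — "phantom holes"). This file is the
formal certificate that the repaired clause cannot be emptied, at every chart time and for every
motion `(Λ, c)`: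

* `radius_axis` — on the symmetry axis the Kerr–Schild radius is `|z|`: `r(a, (τ, 0, 0, z)) = |z|`
  for ALL `a, τ, z` (the tree's `radius_axisPoint` / `radius_axisPt` are the case `z > 0`);
* `truncTimeSlab_boostedKerr_nonempty` (registered stub, closed form) — for every motion `(Λ, c)`,
  all real `M, a` (junk parameters included), every radius `R' > max r₊ 0` and every chart time `τ`,
  the slab `(boostedKerrBackground Λ c M a).truncTimeSlab R' τ` is inhabited, by the boosted axis
  point `Λ (τ, 0, 0, R') + c` (rest-frame time `τ`, rest-frame Kerr–Schild radius `R'`);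
* `truncLateRegion_boostedKerr_nonempty` — the same for the truncated world-tubes
  `truncLateRegion τ₁ R'` (the separation clause of `Recurs` is about nonempty tubes);
* `eventually_truncTimeSlab_boostedKerr_nonempty` — under the exhaustion radii `R τ → ∞` of
  `Recurs` the certified near-zone slabs `truncTimeSlab (R τ) τ` are eventually nonempty;
* `truncTimeSlab_boostedKerr_nonempty_of_isSubextremal` — for the sub-extremal labels of `Recurs`
  (`|a| < M`, so `0 < M < r₊`, `Kerr.rPlus_pos`) the hypothesis is just `r₊ < R'`.

Everything is proved; Mathlib + `Literature` only.
-/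

-- every `Summit.FinalStateConjecture.FinalStateConjecture.…` name repeats the summit = sub-problem segment (D-0017 layout)
set_option linter.dupNamespace false

noncomputable section

open scoped Manifold ContDiff Topology ENNReal
open Set Filter TopologicalSpace

namespace Summit.FinalStateConjecture.FinalStateConjecture.Theorems.ClusterCompleteness

open Literature.Geometry.Lorentzian

/-! ### The Kerr–Schild radius on the axis -/

/-- **On the symmetry axis the Kerr–Schild radius is `|z|`.** For the axis point
`y = (τ, 0, 0, z) = τ • ∂₀ + z • ∂₃` one has `ρ² = ‖y⃗‖² = z²`, the discriminant of the defining
quartic is `(z² − a²)² + 4a²z² = (z² + a²)²`, hence `r² = ((z² − a²) + (z² + a²))/2 = z²` and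
`r = |z|` (`r ≥ 0`). Visser arXiv:0706.0622, (35); the tree's `radius_axisPoint` is the case
`z > 0`. [cite: arXiv07060622, (35)] -/
theorem radius_axis (a τ z : ℝ) :
    Kerr.radius a (τ • E4.basisVector 0 + z • E4.basisVector 3) = |z| := by
  set y : E4 := τ • E4.basisVector 0 + z • E4.basisVector 3 with hy
  have h3 : y 3 = z := by simp [hy]
  have hρ : E4.spatialNorm y ^ 2 = z ^ 2 := by
    rw [E4.spatialNorm_sq]
    simp [hy]
  have hsq : Kerr.radius a y ^ 2 = |z| ^ 2 := by
    rw [Kerr.radius_sq, hρ, h3, sq_abs,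
      show (z ^ 2 - a ^ 2) ^ 2 + 4 * a ^ 2 * z ^ 2 = (z ^ 2 + a ^ 2) ^ 2 by ring,
      Real.sqrt_sq (by positivity)]
    ring
  exact (pow_left_inj₀ (Kerr.radius_nonneg a y) (abs_nonneg z) two_ne_zero).1 hsq

/-! ### No phantom holes -/

/-- **No phantom holes: every truncated boosted-Kerr slab of radius `R' > max r₊ 0` is nonempty.**
For every motion `(Λ, c)`, all real `M, a`, every `R'` with `max (r₊(M, a)) 0 < R'` and every chart
time `τ`, the truncated Kerr–Schild slab `{x ∈ boostedKerrExterior Λ c M a | t*(Λ⁻¹(x − c)) = τ,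
r(Λ⁻¹(x − c)) ≤ R'}` contains the boosted axis point `x = Λ y + c`, `y = (τ, 0, 0, R')`: indeed
`Λ⁻¹(x − c) = y`, `y⁰ = τ` and `r(a, y) = R' > max r₊ 0` (`radius_axis`), so `x` lies in the boosted
exterior `{r ∘ P⁻¹ > max r₊ 0}` and on the slab. Hence under the repaired recurrence clause of
`Recurs k` ("for every radius `R'`") no hole chart is certified on empty slabs only. [folklore] -/
theorem truncTimeSlab_boostedKerr_nonempty : ∀ (Λ : lorentzGroup) (c : E4) (M a : ℝ) {R' : ℝ}, max (Kerr.rPlus M a) 0 < R' → ∀ τ : ℝ, ((boostedKerrBackground Λ c M a).truncTimeSlab R' τ).Nonempty := by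
  intro Λ c M a R' hR' τ
  set y : E4 := τ • E4.basisVector 0 + R' • E4.basisVector 3 with hy
  have hinv : poincareInv Λ c ((Λ : E4 ≃L[ℝ] E4) y + c) = y := by simp [poincareInv]
  have hr : Kerr.radius a y = R' := by
    rw [hy, radius_axis, abs_of_pos ((le_max_right _ _).trans_lt hR')]
  have hmem : (Λ : E4 ≃L[ℝ] E4) y + c ∈ boostedKerrExterior Λ c M a := by
    rw [mem_boostedKerrExterior, hinv, Kerr.mem_exterior, hr]
    exact hR'
  refine ⟨⟨(Λ : E4 ≃L[ℝ] E4) y + c, hmem⟩, ?_, ?_⟩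
  · show poincareInv Λ c ((Λ : E4 ≃L[ℝ] E4) y + c) 0 = τ
    rw [hinv]
    simp [hy]
  · show Kerr.radius a (poincareInv Λ c ((Λ : E4 ≃L[ℝ] E4) y + c)) ≤ R'
    rw [hinv, hr]

/-- **Truncated boosted-Kerr world-tubes are nonempty.** For `R' > max r₊ 0` and every `τ₁` the
truncated late region `{x | τ₁ < t*(Λ⁻¹(x − c)), r(Λ⁻¹(x − c)) ≤ R'}` of `boostedKerrBackground Λ c M a`
is nonempty: it contains the (nonempty) slab at chart time `τ₁ + 1`. [folklore] -/
theorem truncLateRegion_boostedKerr_nonempty (Λ : lorentzGroup) (c : E4) (M a : ℝ) {R' : ℝ}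
    (hR' : max (Kerr.rPlus M a) 0 < R') (τ₁ : ℝ) :
    ((boostedKerrBackground Λ c M a).truncLateRegion τ₁ R').Nonempty := by
  obtain ⟨x, hx⟩ := truncTimeSlab_boostedKerr_nonempty Λ c M a hR' (τ₁ + 1)
  rw [ModelBackground.mem_truncTimeSlab] at hx
  refine ⟨x, ?_, hx.2⟩
  rw [hx.1]
  exact lt_add_one τ₁

/-- **The certified near-zone slabs of `Recurs` are eventually nonempty.** If the exhaustion radii
`R τ → ∞` (clause `Tendsto (R i) atTop atTop` of `Recurs k`), then for all late chart times `τ` the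
certified slab `truncTimeSlab (R τ) τ` of `boostedKerrBackground Λ c M a` is nonempty (as soon as
`R τ > max r₊ 0`, `Filter.Tendsto.eventually_gt_atTop`). [folklore] -/
theorem eventually_truncTimeSlab_boostedKerr_nonempty (Λ : lorentzGroup) (c : E4) (M a : ℝ)
    {R : ℝ → ℝ} (hR : Tendsto R atTop atTop) :
    ∀ᶠ τ in atTop, ((boostedKerrBackground Λ c M a).truncTimeSlab (R τ) τ).Nonempty :=
  (hR.eventually_gt_atTop (max (Kerr.rPlus M a) 0)).mono fun τ hτ ↦
    truncTimeSlab_boostedKerr_nonempty Λ c M a hτ τ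

/-- **No phantom holes, sub-extremal labels.** For sub-extremal parameters `|a| < M` (the labels of
`Recurs k`, `Kerr.IsSubextremal`) one has `0 < M ≤ r₊` (`Kerr.IsSubextremal.pos`, `Kerr.rPlus_pos`),
so every truncated slab of radius `R' > r₊` of `boostedKerrBackground Λ c M a` is nonempty at every
chart time. [folklore] -/
theorem truncTimeSlab_boostedKerr_nonempty_of_isSubextremal (Λ : lorentzGroup) (c : E4) {M a : ℝ}
    (hMa : Kerr.IsSubextremal M a) {R' : ℝ} (hR' : Kerr.rPlus M a < R') (τ : ℝ) :
    ((boostedKerrBackground Λ c M a).truncTimeSlab R' τ).Nonempty :=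
  truncTimeSlab_boostedKerr_nonempty Λ c M a
    (max_lt hR' ((Kerr.rPlus_pos hMa.pos a).trans hR')) τ

/-- **Sub-extremal world-tubes are nonempty.** For `|a| < M`, `r₊ < R'` and every `τ₁` the truncated
late region `truncLateRegion τ₁ R'` of `boostedKerrBackground Λ c M a` is nonempty. [folklore] -/
theorem truncLateRegion_boostedKerr_nonempty_of_isSubextremal (Λ : lorentzGroup) (c : E4)
    {M a : ℝ} (hMa : Kerr.IsSubextremal M a) {R' : ℝ} (hR' : Kerr.rPlus M a < R') (τ₁ : ℝ) :
    ((boostedKerrBackground Λ c M a).truncLateRegion τ₁ R').Nonempty :=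
  truncLateRegion_boostedKerr_nonempty Λ c M a
    (max_lt hR' ((Kerr.rPlus_pos hMa.pos a).trans hR')) τ₁

end Summit.FinalStateConjecture.FinalStateConjecture.Theorems.ClusterCompleteness

end
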